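import Literature.Analysis.ODE.RecessiveDominance
import HarnessLib

/-!
# Chained growth of the recessive / growing branch across a partitioned barrier

Topic `Literature/Analysis/ODE` (namespace `Literature.Analysis.ODE`), continuing
`RecessiveDominance.lean` (`mul_cosh_le_of_sq_le_coeff_left/right`: on ONE interval where `q ≥ k²`,
a non-increasing positive solution of `y″ = q y` grows to the left at least like `cosh k·length`).
When the coefficient varies over many orders of magnitude along a long barrier (Carter's equation
near an extremal horizon: `q` from `κ²Λ` at the collar to `Λ/M²` at the photon sphere to `0` at the
far turning point), a single constant `k` is hopeless; the right lower bound for the total growth is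
the PRODUCT of the piecewise ones over a partition `t 0 ≤ t 1 ≤ ⋯ ≤ t n` with `q ≥ (k i)²` on
`[t i, t (i+1)]`:

* `prod_cosh_mul_le_of_partition` — RECESSIVE branch: `d″ = q d`, `q ≥ 0`, `d ≥ 0` on
  `[t 0, t n]`, `d′(t n) ≤ 0`: `d(t n) · ∏_{i<n} cosh(k i·(t (i+1) − t i)) ≤ d(t 0)`
  (induction on `n`; `d′` is non-decreasing, so `d′(t i) ≤ 0` at every partition point);
* `prod_cosh_mul_le_of_partition_right` — GROWING branch: `g″ = q g`, `q ≥ 0`, `g ≥ 0`,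
  `g′(t 0) ≥ 0`: `g(t 0) · ∏_{i<n} cosh(k i·(t (i+1) − t i)) ≤ g(t n)`;
* `exp_sum_le_two_pow_mul_prod_cosh` — the bookkeeping inequality
  `exp(∑ k i·ℓ i) ≤ 2^n · ∏ cosh(k i·ℓ i)` (`e^x ≤ 2cosh x`), turning the product into the
  Agmon-type exponential `e^{∑ k_i ℓ_i}` at the price `2^n` (polynomial for dyadic partitions).

Used to certify the DEPTH hypothesis `4P₁² ≤ |F|·d(α)·w₀` of
`RecessiveDominance.re_conj_mul_deriv_le_of_right_flux` along the barrier of Carter's radial equation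
(near-extremal Kerr programme, threshold cone). Everything is proved; pointwise `HasDerivAt`
hypotheses on the closed interval.

## References
* P. Hartman, *Ordinary Differential Equations* (SIAM Classics 38, 2002), Ch. XI §§3, 6.
  Key `Hartman2002`.
* S. Agmon, *Lectures on Exponential Decay of Solutions of Second-Order Elliptic Equations*,
  Princeton Math. Notes 29 (1982), Ch. 1 (the exponential weight `e^{∫√q}`).
-/

noncomputable section

open Set Finset

namespace Literature.Analysis.ODE

/-- A partition monotone step by step up to `n` is monotone up to `n`. [folklore] -/
theorem partition_mono {t : ℕ → ℝ} {n : ℕ} (ht : ∀ i < n, t i ≤ t (i + 1)) :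
    ∀ j ≤ n, ∀ i ≤ j, t i ≤ t j := by
  intro j
  induction j with
  | zero => intro _ i hi; rw [Nat.le_zero.1 hi]
  | succ j ih =>
    intro hj i hi
    rcases Nat.of_le_succ hi with h | h
    · exact (ih (Nat.le_of_succ_le hj) i h).trans (ht j (Nat.lt_of_succ_le hj))
    · rw [h]

/-- The derivative of a non-negative solution of `d″ = q d`, `q ≥ 0`, is non-decreasing on the
interval: `d′(x) ≤ d′(y)` for `x ≤ y`. [folklore] -/
theorem deriv_monotoneOn_of_nonneg {d d' q : ℝ → ℝ} {α β : ℝ}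
    (hd : ∀ s ∈ Icc α β, HasDerivAt d (d' s) s ∧ HasDerivAt d' (q s * d s) s)
    (hq0 : ∀ s ∈ Icc α β, 0 ≤ q s) (hd0 : ∀ s ∈ Icc α β, 0 ≤ d s) : MonotoneOn d' (Icc α β) :=
  monotoneOn_of_deriv_nonneg (convex_Icc α β)
    (fun s hs ↦ (hd s hs).2.continuousAt.continuousWithinAt)
    (fun s hs ↦ (hd s (interior_subset hs)).2.differentiableAt.differentiableWithinAt)
    fun s hs ↦ by
      have hs' : s ∈ Icc α β := interior_subset hs
      rw [(hd s hs').2.deriv]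
      exact mul_nonneg (hq0 s hs') (hd0 s hs')

/-- **Chained cosh growth of the recessive branch.** Let `t 0 ≤ t 1 ≤ ⋯ ≤ t n`, `d″ = q d` on
`[t 0, t n]` with `q ≥ 0`, `d ≥ 0` there, `d′(t n) ≤ 0`, and `q ≥ (k i)²` on each piece
`[t i, t (i+1)]` (`i < n`). Then `d(t n) · ∏_{i<n} cosh(k i·(t (i+1) − t i)) ≤ d(t 0)`.
[cite: Hartman2002, Ch. XI Thm. 3.2 and Ex. 3.1(a)] -/
theorem prod_cosh_mul_le_of_partition {d d' q : ℝ → ℝ} (n : ℕ) (t : ℕ → ℝ) (k : ℕ → ℝ)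
    (ht : ∀ i < n, t i ≤ t (i + 1))
    (hd : ∀ s ∈ Icc (t 0) (t n), HasDerivAt d (d' s) s ∧ HasDerivAt d' (q s * d s) s)
    (hq0 : ∀ s ∈ Icc (t 0) (t n), 0 ≤ q s)
    (hqk : ∀ i < n, ∀ s ∈ Icc (t i) (t (i + 1)), k i ^ 2 ≤ q s)
    (hd0 : ∀ s ∈ Icc (t 0) (t n), 0 ≤ d s) (hdn : d' (t n) ≤ 0) :
    d (t n) * ∏ i ∈ range n, Real.cosh (k i * (t (i + 1) - t i)) ≤ d (t 0) := by
  induction n with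
  | zero => simp
  | succ n ih =>
    have htm := partition_mono ht
    have h0n : t 0 ≤ t n := htm n (Nat.le_succ n) 0 (Nat.zero_le n)
    have hn1 : t n ≤ t (n + 1) := ht n (Nat.lt_succ_self n)
    have hsub : Icc (t 0) (t n) ⊆ Icc (t 0) (t (n + 1)) := Icc_subset_Icc_right hn1
    have hsub' : Icc (t n) (t (n + 1)) ⊆ Icc (t 0) (t (n + 1)) := Icc_subset_Icc_left h0n
    -- `d′(t n) ≤ d′(t (n+1)) ≤ 0`
    have hmono := deriv_monotoneOn_of_nonneg hd hq0 hd0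
    have hdn' : d' (t n) ≤ 0 :=
      (hmono ⟨h0n, hn1⟩ (right_mem_Icc.2 (h0n.trans hn1)) hn1).trans hdn
    -- the last piece
    have hlast : d (t (n + 1)) * Real.cosh (k n * (t (n + 1) - t n)) ≤ d (t n) :=
      mul_cosh_le_of_sq_le_coeff_left (fun s hs ↦ hd s (hsub' hs))
        (hqk n (Nat.lt_succ_self n)) (fun s hs ↦ hd0 s (hsub' hs)) hdn (t n)
        (left_mem_Icc.2 hn1)
    -- the first `n` pieces
    have hfirst := ih (fun i hi ↦ ht i (Nat.lt_succ_of_lt hi)) (fun s hs ↦ hd s (hsub hs))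
      (fun s hs ↦ hq0 s (hsub hs)) (fun i hi ↦ hqk i (Nat.lt_succ_of_lt hi))
      (fun s hs ↦ hd0 s (hsub hs)) hdn'
    have hP : 0 ≤ ∏ i ∈ range n, Real.cosh (k i * (t (i + 1) - t i)) :=
      prod_nonneg fun i _ ↦ (Real.cosh_pos _).le
    rw [prod_range_succ]
    calc d (t (n + 1)) * ((∏ i ∈ range n, Real.cosh (k i * (t (i + 1) - t i))) *
          Real.cosh (k n * (t (n + 1) - t n)))
        = (d (t (n + 1)) * Real.cosh (k n * (t (n + 1) - t n))) *
          ∏ i ∈ range n, Real.cosh (k i * (t (i + 1) - t i)) := by ring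
      _ ≤ d (t n) * ∏ i ∈ range n, Real.cosh (k i * (t (i + 1) - t i)) :=
          mul_le_mul_of_nonneg_right hlast hP
      _ ≤ d (t 0) := hfirst

/-- **Chained cosh growth of the growing branch** (mirror statement): `t 0 ≤ ⋯ ≤ t n`, `g″ = q g` on
`[t 0, t n]` with `q ≥ 0`, `g ≥ 0`, `g′(t 0) ≥ 0`, and `q ≥ (k i)²` on each piece. Then
`g(t 0) · ∏_{i<n} cosh(k i·(t (i+1) − t i)) ≤ g(t n)`. [cite: Hartman2002, Ch. XI Thm. 3.2 and Ex. 3.1(a)] -/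
theorem prod_cosh_mul_le_of_partition_right {g g' q : ℝ → ℝ} (n : ℕ) (t : ℕ → ℝ) (k : ℕ → ℝ)
    (ht : ∀ i < n, t i ≤ t (i + 1))
    (hg : ∀ s ∈ Icc (t 0) (t n), HasDerivAt g (g' s) s ∧ HasDerivAt g' (q s * g s) s)
    (hq0 : ∀ s ∈ Icc (t 0) (t n), 0 ≤ q s)
    (hqk : ∀ i < n, ∀ s ∈ Icc (t i) (t (i + 1)), k i ^ 2 ≤ q s)
    (hg0 : ∀ s ∈ Icc (t 0) (t n), 0 ≤ g s) (hg'0 : 0 ≤ g' (t 0)) :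
    g (t 0) * ∏ i ∈ range n, Real.cosh (k i * (t (i + 1) - t i)) ≤ g (t n) := by
  induction n with
  | zero => simp
  | succ n ih =>
    have htm := partition_mono ht
    have h0n : t 0 ≤ t n := htm n (Nat.le_succ n) 0 (Nat.zero_le n)
    have hn1 : t n ≤ t (n + 1) := ht n (Nat.lt_succ_self n)
    have hsub : Icc (t 0) (t n) ⊆ Icc (t 0) (t (n + 1)) := Icc_subset_Icc_right hn1
    have hsub' : Icc (t n) (t (n + 1)) ⊆ Icc (t 0) (t (n + 1)) := Icc_subset_Icc_left h0n
    -- `0 ≤ g′(t 0) ≤ g′(t n)`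
    have hmono := deriv_monotoneOn_of_nonneg hg hq0 hg0
    have hgn : 0 ≤ g' (t n) :=
      hg'0.trans (hmono (left_mem_Icc.2 (h0n.trans hn1)) ⟨h0n, hn1⟩ h0n)
    have hlast : g (t n) * Real.cosh (k n * (t (n + 1) - t n)) ≤ g (t (n + 1)) :=
      mul_cosh_le_of_sq_le_coeff_right (fun s hs ↦ hg s (hsub' hs))
        (hqk n (Nat.lt_succ_self n)) (fun s hs ↦ hg0 s (hsub' hs)) hgn (t (n + 1))
        (right_mem_Icc.2 hn1)
    have hfirst := ih (fun i hi ↦ ht i (Nat.lt_succ_of_lt hi)) (fun s hs ↦ hg s (hsub hs))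
      (fun s hs ↦ hq0 s (hsub hs)) (fun i hi ↦ hqk i (Nat.lt_succ_of_lt hi))
      (fun s hs ↦ hg0 s (hsub hs))
    have hC : 0 ≤ Real.cosh (k n * (t (n + 1) - t n)) := (Real.cosh_pos _).le
    rw [prod_range_succ]
    calc g (t 0) * ((∏ i ∈ range n, Real.cosh (k i * (t (i + 1) - t i))) *
          Real.cosh (k n * (t (n + 1) - t n)))
        = (g (t 0) * ∏ i ∈ range n, Real.cosh (k i * (t (i + 1) - t i))) *
          Real.cosh (k n * (t (n + 1) - t n)) := by ring
      _ ≤ g (t n) * Real.cosh (k n * (t (n + 1) - t n)) := mul_le_mul_of_nonneg_right hfirst hC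
      _ ≤ g (t (n + 1)) := hlast

/-- `e^x ≤ 2 cosh x`. [folklore] -/
theorem exp_le_two_mul_cosh (x : ℝ) : Real.exp x ≤ 2 * Real.cosh x := by
  rw [Real.cosh_eq]
  have := Real.exp_pos (-x)
  linarith

/-- **From the product of cosh to the Agmon exponential**: for any reals `x i`,
`exp(∑_{i<n} x i) ≤ 2^n · ∏_{i<n} cosh(x i)`. [folklore] -/
theorem exp_sum_le_two_pow_mul_prod_cosh (n : ℕ) (x : ℕ → ℝ) :
    Real.exp (∑ i ∈ range n, x i) ≤ 2 ^ n * ∏ i ∈ range n, Real.cosh (x i) := by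
  induction n with
  | zero => simp
  | succ n ih =>
    rw [sum_range_succ, prod_range_succ, Real.exp_add, pow_succ]
    have h1 := exp_le_two_mul_cosh (x n)
    have hP : 0 ≤ 2 ^ n * ∏ i ∈ range n, Real.cosh (x i) :=
      mul_nonneg (pow_nonneg zero_le_two _) (prod_nonneg fun i _ ↦ (Real.cosh_pos _).le)
    calc Real.exp (∑ i ∈ range n, x i) * Real.exp (x n)
        ≤ (2 ^ n * ∏ i ∈ range n, Real.cosh (x i)) * (2 * Real.cosh (x n)) :=
          mul_le_mul ih h1 (Real.exp_pos _).le hP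
      _ = 2 ^ n * 2 * ((∏ i ∈ range n, Real.cosh (x i)) * Real.cosh (x n)) := by ring

end Literature.Analysis.ODE

end
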